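import Mathlib
import Summits.CriticalPhenomena.CardyFormulaZ2.Theorems.CardySelfRefinementDefs
import Summits.CriticalPhenomena.CardyFormulaZ2.Theorems.CardySelfRefinementGradientComparabilityStubSlopeBoundsCornerTransfer3Cell
import Summits.CriticalPhenomena.CardyFormulaZ2.Theorems.CardySelfRefinementGradientComparabilityStubSlopeBoundsCornerTransfer
import HarnessLib

/-!
# Crux `GradientComparability` (stmt-CriticalPhenomena-10269), line `monotone-product-coordinates` —
# stub `stub_cornerLocalSlope` (LOC), corner transfer (B″₃), part 3: the measure bounds for
# `k = 3` — a far interior edge of `M_3(ρ,c)` is pivotal at most `4369/(1−c)` times as often as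
# the side bundles of its cell are set-pivotal; summed, `∂cP_far ≤ 314568/(1−c) · N_{S'}`

Route `CardySelfRefinement`, sub-problem `CriticalPhenomena/CardyFormulaZ2`; vocabulary from
`CardySelfRefinementDefs` (`ax tb prm M Aloc edgeOf dirVec`); the pointwise corner transfer of part 2
(`exists_setPivotal_side_of_isPivotal_three`), `interior_edge_notMem_bundleSet_three` (part 1),
the cheap moves `one_sub_mul_real_sdiff_mem_le` (closing an interior edge costs `1/(1−c)`) and
`real_union_bundle_mem_le` (forcing a bundle open costs `2^{k+1} = 16`) of
`…StubSlopeBoundsCorner{Penalty,PenaltySum}`, and `exists_eq_edgeOf_of_adj` (`…StubNonAxialShareBulk`);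
the `k = 2` twins are `…StubSlopeBoundsCornerTransfer{,Sum}`.

## Mathematics

Brick (B″₃) of the signed domination (SD) behind the local corner slope bound: for `k = 3`, any
real `ρ` (the corner `ρ = 1` included — no selector is touched), `0 ≤ c < 1`, a cell of base `z`,
an interior vertex `x ∈ 3z + {1,2}²` drawn at distance `≥ r ≥ 20η` from every side of every quad
of the family (any `m`), and a lattice edge `e = {x, μ}`,

`M_3(ρ,c)(e pivotal for Aloc) ≤ 4369/(1−c) · ( M(PIV_S) + M(PIV_E) + M(PIV_N) + M(PIV_W) )`,

`PIV_B = {ω ∪ B ∈ Aloc ∧ ω ∖ B ∉ Aloc}` the set-pivotality of the side bundles `S = (z,0)`,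
`E = (z+e₀,1)`, `N = (z+e₁,0)`, `W = (z,1)` — the currency `N_S` of the penalty half
`Drho_add_mul_Dc_ge_of_far`.  Proof (`real_isPivotal_edge_le_three`): by part 2,
`{e pivotal} ⊆ ⋃_{j ≤ 4} {ω ∖ {e} ∪ B₁ ∪ ⋯ ∪ B_{j−1} ∈ PIV_{B_j}}`; closing the interior edge `e`
costs `1/(1−c)` and each tying `16`, so the four terms cost `(1 + 16 + 256 + 4096)/(1−c)`.
`real_isPivotal_interior_le_three` (registered) restates this for a non-axial `edgeOf (v, d)` with
both ends far, the cell being `tb 3 (v, d)` (the form of the non-axial window edges `Wn` of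
`stub_Dc_eq_sum_pivotal`): one end of a non-axial edge is an interior vertex of its cell
(`exists_interior_end_of_not_ax_three`).

Summed (`sum_real_isPivotal_interior_le_three`, registered): for a finite set `VD` of such labels and
any finite set `S'` of selector coins containing the four side selectors `(z,0,2)`, `(z+e₀,1,2)`,
`(z+e₁,0,2)`, `(z,1,2)` of the cell `z = tb 3 vd` of every `vd ∈ VD`,
`Σ_{vd ∈ VD} M(edgeOf vd pivotal) ≤ 314568/(1−c) · Σ_{i ∈ S'} M(PIV_i)`: at most `18` labels share a
cell (`card_filter_tb_eq_le_eighteen`) and each of the four side maps is injective, so every `PIV_i`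
is charged at most `72` times (`314568 = 72 · 4369`).  With `stub_Dc_eq_sum_pivotal` this is the
corner transfer (B″₃) `∂cP_far ≤ C₂ N_{S'}` of the signed domination for `k = 3`.
-/

noncomputable section

namespace Summit.CriticalPhenomena.CardyFormulaZ2.Theorems.CardySelfRefinement

open scoped Topology
open Filter Set MeasureTheory
open Literature.Probability.LatticeModels Literature.Probability.Percolation
open Literature.Probability.Percolation.QuadCrossing
open Summit.CriticalPhenomena.CardyFormulaZ2.Theses.CardySelfRefinement

/-! ## Interior edges as non-axial `edgeOf`s, and conversely -/

/-- An edge `{x, μ}` at an interior vertex `x ∈ 3z + {1,2}²` of the `k = 3` cell of base `z` is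
`edgeOf (v, d)` for a NON-AXIAL `(v, d)` (no edge at an interior vertex is axial). -/
theorem exists_eq_edgeOf_not_ax_of_interior_three {k : ℕ} (hk : k = 3) (z : Site 2) {x μ : Site 2}
    (hx : ∀ l, x l = (k : ℤ) * z l + 1 ∨ x l = (k : ℤ) * z l + 2) (hxμ : (zdGraph 2).Adj x μ) :
    ∃ (v : Site 2) (d : Fin 2), s(x, μ) = edgeOf (v, d) ∧ ¬ ax k (v, d) := by
  have key : ∀ (v : Site 2) (d : Fin 2), s(x, μ) = edgeOf (v, d) → ¬ ax k (v, d) := fun v d hvd hax =>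
    interior_edge_notMem_bundleSet_three k hk z x hx μ (tb k (v, d)) d ⟨(v, d), ⟨hax, rfl, rfl⟩, hvd.symm⟩
  obtain ⟨d, hd | hd⟩ := exists_eq_edgeOf_of_adj hxμ
  · exact ⟨_, d, hd, key _ d hd⟩
  · exact ⟨_, d, hd, key _ d hd⟩

/-- **One end of a non-axial edge is an interior vertex of its cell.**  For `k = 3` and
`¬ ax 3 (v, d)`, the edge `edgeOf (v, d) = {v, v + e_d}` is `{x, μ}` with `x ∈ 3z + {1,2}²`,
`z = tb 3 (v, d)` the base of its cell (`x = v` unless `v` lies on the coarse line across the edge,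
in which case `x = v + e_d`). -/
theorem exists_interior_end_of_not_ax_three {k : ℕ} (hk : k = 3) {v : Site 2} {d : Fin 2} (hax : ¬ ax k (v, d)) :
    ∃ x μ : Site 2, edgeOf (v, d) = s(x, μ) ∧ (zdGraph 2).Adj x μ ∧
      (∀ l, x l = (k : ℤ) * tb k (v, d) l + 1 ∨ x l = (k : ℤ) * tb k (v, d) l + 2) ∧ x ∈ edgeOf (v, d) := by
  subst hk
  have hdv : (dirVec d : Site 2) = Pi.single d 1 := dirVec_eq_single d
  have hperp : (if d = 0 then (1 : Fin 2) else 0) ≠ d := by fin_cases d <;> decide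
  have hax' : ¬ ((3 : ℕ) : ℤ) ∣ v (if d = 0 then 1 else 0) := hax
  have hzl : ∀ l, tb 3 (v, d) l = v l / ((3 : ℕ) : ℤ) := fun l => rfl
  have hadj : (zdGraph 2).Adj v (v + dirVec d) := by
    rw [zdGraph_adj_iff]
    exact ⟨d, Or.inl (by rw [hdv])⟩
  have hl : ∀ l : Fin 2, l = d ∨ l = (if d = 0 then (1 : Fin 2) else 0) := by
    intro l
    fin_cases d <;> fin_cases l <;> simp
  by_cases hvd : ((3 : ℕ) : ℤ) ∣ v d
  · -- `v` lies on the coarse line across the edge: the far end `v + e_d` is interior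
    refine ⟨v + dirVec d, v, by rw [Sym2.eq_swap], hadj.symm, fun l => ?_, Sym2.mem_mk_right _ _⟩
    rw [hzl]
    simp only [Pi.add_apply, hdv, Pi.single_apply]
    rcases hl l with h | h <;> rw [h]
    · rw [if_pos rfl]
      omega
    · rw [if_neg hperp]
      omega
  · refine ⟨v, v + dirVec d, rfl, hadj, fun l => ?_, Sym2.mem_mk_left _ _⟩
    rw [hzl]
    rcases hl l with h | h <;> rw [h]
    · omega
    · omega

/-! ## The measure bound per edge at an interior vertex -/

/-- **Corner transfer (B″₃), per interior edge at an interior vertex.**  For `k = 3`, `0 < η`,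
`20η ≤ r`, any real `ρ`, `0 ≤ c < 1`, a cell of base `z`, an interior vertex `x ∈ 3z + {1,2}²`
drawn `r`-far from every side of every quad, and a lattice edge `{x, μ}`:
`M_3(ρ,c)({x,μ} pivotal for Aloc) ≤ 4369/(1−c) · (M(PIV_S) + M(PIV_E) + M(PIV_N) + M(PIV_W))` with
the side bundles `S = (z,0)`, `E = (z+e₀,1)`, `N = (z+e₁,0)`, `W = (z,1)` (pointwise transfer of
part 2, closing `e` at cost `1/(1−c)`, tying at cost `16` per bundle: `4369 = 1 + 16 + 256 + 4096`). -/
theorem real_isPivotal_edge_le_three {k : ℕ} (hk : k = 3) (m : ℕ) (F : Fin m → Quad (Set.univ : Set ℂ))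
    {η r : ℝ} (hη : 0 < η) (hηr : 20 * η ≤ r) (ρ c : ℝ) (hc : c ∈ Set.Ico (0 : ℝ) 1) (z : Site 2)
    {x μ : Site 2} (hx : ∀ l, x l = (k : ℤ) * z l + 1 ∨ x l = (k : ℤ) * z l + 2)
    (hxμ : (zdGraph 2).Adj x μ)
    (hfar : ∀ (i : Fin m) (j : Fin 4), ∀ p ∈ (F i).side j, r ≤ dist ((η : ℂ) * squareLatticeEmbedding.z x) p) :
    (M k ρ c).real {ω | IsPivotal (Aloc m F η) s(x, μ) ω} ≤ 4369 / (1 - c) *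
      ((M k ρ c).real {ω | ω ∪ edgeOf '' {vd : Site 2 × Fin 2 | ax k vd ∧ tb k vd = z ∧ vd.2 = 0} ∈ Aloc m F η ∧
          ω \ edgeOf '' {vd : Site 2 × Fin 2 | ax k vd ∧ tb k vd = z ∧ vd.2 = 0} ∉ Aloc m F η} +
        (M k ρ c).real {ω | ω ∪ edgeOf '' {vd : Site 2 × Fin 2 | ax k vd ∧ tb k vd = z + Pi.single 0 1 ∧ vd.2 = 1} ∈ Aloc m F η ∧
          ω \ edgeOf '' {vd : Site 2 × Fin 2 | ax k vd ∧ tb k vd = z + Pi.single 0 1 ∧ vd.2 = 1} ∉ Aloc m F η} +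
        (M k ρ c).real {ω | ω ∪ edgeOf '' {vd : Site 2 × Fin 2 | ax k vd ∧ tb k vd = z + Pi.single 1 1 ∧ vd.2 = 0} ∈ Aloc m F η ∧
          ω \ edgeOf '' {vd : Site 2 × Fin 2 | ax k vd ∧ tb k vd = z + Pi.single 1 1 ∧ vd.2 = 0} ∉ Aloc m F η} +
        (M k ρ c).real {ω | ω ∪ edgeOf '' {vd : Site 2 × Fin 2 | ax k vd ∧ tb k vd = z ∧ vd.2 = 1} ∈ Aloc m F η ∧
          ω \ edgeOf '' {vd : Site 2 × Fin 2 | ax k vd ∧ tb k vd = z ∧ vd.2 = 1} ∉ Aloc m F η}) := by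
  subst hk
  haveI := isProbabilityMeasure_M 3 ρ c
  set A : Set (BondConfig (Site 2)) := Aloc m F η with hA
  have hAm : MeasurableSet A := measurableSet_Aloc m F hη.ne'
  set Bs : Site 2 → Fin 2 → Set (Sym2 (Site 2)) :=
    fun t d => edgeOf '' {vd : Site 2 × Fin 2 | ax 3 vd ∧ tb 3 vd = t ∧ vd.2 = d} with hBs
  set PIV : Set (Sym2 (Site 2)) → Set (BondConfig (Site 2)) := fun B => {ω | ω ∪ B ∈ A ∧ ω \ B ∉ A} with hPIV
  -- measurability
  have hPIVm : ∀ B, MeasurableSet (PIV B) := fun B =>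
    ((measurable_set_iff.2 fun x => (measurable_set_mem x).or measurable_const :
        Measurable fun ω : BondConfig (Site 2) => ω ∪ B) hAm).inter
      ((measurable_set_iff.2 fun x => (measurable_set_mem x).and measurable_const :
        Measurable fun ω : BondConfig (Site 2) => ω \ B) hAm).compl
  have hUm : ∀ (B : Set (Sym2 (Site 2))) {X : Set (BondConfig (Site 2))}, MeasurableSet X →
      MeasurableSet {ω : BondConfig (Site 2) | ω ∪ B ∈ X} := fun B X hX =>
    (measurable_set_iff.2 fun x => (measurable_set_mem x).or measurable_const :
      Measurable fun ω : BondConfig (Site 2) => ω ∪ B) hX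
  -- the spoke as a non-axial `edgeOf`, and the cost of closing it
  obtain ⟨v, d, hvd, hax⟩ := exists_eq_edgeOf_not_ax_of_interior_three rfl z hx hxμ
  have hc1 : 0 < 1 - c := by linarith [hc.2]
  have hclose : ∀ {X : Set (BondConfig (Site 2))}, MeasurableSet X →
      (M 3 ρ c).real {ω | ω \ {s(x, μ)} ∈ X} ≤ 1 / (1 - c) * (M 3 ρ c).real X := by
    intro X hX
    have hp : (prm 3 ρ c (v, d, 0) : ℝ) = c := by
      simp [prm, hax, Set.projIcc_of_mem _ (Set.Ico_subset_Icc_self hc)]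
    have h := one_sub_mul_real_sdiff_mem_le 3 hax ρ c hX
    rw [hp, ← hvd] at h
    rw [one_div, ← div_eq_inv_mul, le_div_iff₀ hc1]
    linarith
  -- the cost of tying a bundle
  have htie : ∀ (t : Site 2) (dd : Fin 2) {X : Set (BondConfig (Site 2))}, MeasurableSet X →
      (M 3 ρ c).real {ω | ω ∪ Bs t dd ∈ X} ≤ 16 * (M 3 ρ c).real X := fun t dd X hX =>
    calc (M 3 ρ c).real {ω | ω ∪ Bs t dd ∈ X} ≤ 2 ^ (3 + 1) * (M 3 ρ c).real X :=
          real_union_bundle_mem_le (k := 3) (by norm_num) ρ c t dd hX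
      _ = 16 * (M 3 ρ c).real X := by norm_num
  -- the four events of the chain
  set E₁ : Set (BondConfig (Site 2)) := PIV (Bs z 0) with hE₁
  set E₂ : Set (BondConfig (Site 2)) := {ω | ω ∪ Bs z 0 ∈ PIV (Bs (z + Pi.single 0 1) 1)} with hE₂
  set E₃ : Set (BondConfig (Site 2)) :=
    {ω | ω ∪ Bs z 0 ∈ {ω' : BondConfig (Site 2) | ω' ∪ Bs (z + Pi.single 0 1) 1 ∈ PIV (Bs (z + Pi.single 1 1) 0)}} with hE₃
  set E₄ : Set (BondConfig (Site 2)) :=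
    {ω | ω ∪ Bs z 0 ∈ {ω' : BondConfig (Site 2) | ω' ∪ Bs (z + Pi.single 0 1) 1 ∈
      {ω'' : BondConfig (Site 2) | ω'' ∪ Bs (z + Pi.single 1 1) 0 ∈ PIV (Bs z 1)}}} with hE₄
  have hcover : {ω | IsPivotal A s(x, μ) ω} ⊆ {ω | ω \ {s(x, μ)} ∈ E₁} ∪ {ω | ω \ {s(x, μ)} ∈ E₂} ∪
      {ω | ω \ {s(x, μ)} ∈ E₃} ∪ {ω | ω \ {s(x, μ)} ∈ E₄} := by
    intro ω hω
    rcases exists_setPivotal_side_of_isPivotal_three 3 m rfl F η r hη hηr z x μ ω hx hxμ hfar hω with h | h | h | h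
    · exact Or.inl (Or.inl (Or.inl h))
    · exact Or.inl (Or.inl (Or.inr h))
    · exact Or.inl (Or.inr h)
    · exact Or.inr h
  have h1 : (M 3 ρ c).real {ω | ω \ {s(x, μ)} ∈ E₁} ≤ 1 / (1 - c) * (M 3 ρ c).real (PIV (Bs z 0)) :=
    hclose (hPIVm _)
  have h2 : (M 3 ρ c).real {ω | ω \ {s(x, μ)} ∈ E₂} ≤
      1 / (1 - c) * (16 * (M 3 ρ c).real (PIV (Bs (z + Pi.single 0 1) 1))) := by
    refine (hclose (hUm _ (hPIVm _))).trans ?_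
    gcongr
    exact htie z 0 (hPIVm _)
  have h3 : (M 3 ρ c).real {ω | ω \ {s(x, μ)} ∈ E₃} ≤
      1 / (1 - c) * (16 * (16 * (M 3 ρ c).real (PIV (Bs (z + Pi.single 1 1) 0)))) := by
    refine (hclose (hUm _ (hUm _ (hPIVm _)))).trans ?_
    gcongr
    refine (htie z 0 (hUm _ (hPIVm _))).trans ?_
    gcongr
    exact htie _ 1 (hPIVm _)
  have h4 : (M 3 ρ c).real {ω | ω \ {s(x, μ)} ∈ E₄} ≤
      1 / (1 - c) * (16 * (16 * (16 * (M 3 ρ c).real (PIV (Bs z 1))))) := by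
    refine (hclose (hUm _ (hUm _ (hUm _ (hPIVm _))))).trans ?_
    gcongr
    refine (htie z 0 (hUm _ (hUm _ (hPIVm _)))).trans ?_
    gcongr
    refine (htie _ 1 (hUm _ (hPIVm _))).trans ?_
    gcongr
    exact htie _ 0 (hPIVm _)
  have hq : 0 ≤ 1 / (1 - c) := by positivity
  have hP : ∀ B, 0 ≤ (M 3 ρ c).real (PIV B) := fun B => measureReal_nonneg
  calc (M 3 ρ c).real {ω | IsPivotal A s(x, μ) ω}
      ≤ (M 3 ρ c).real ({ω | ω \ {s(x, μ)} ∈ E₁} ∪ {ω | ω \ {s(x, μ)} ∈ E₂} ∪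
          {ω | ω \ {s(x, μ)} ∈ E₃} ∪ {ω | ω \ {s(x, μ)} ∈ E₄}) := measureReal_mono hcover
    _ ≤ (M 3 ρ c).real {ω | ω \ {s(x, μ)} ∈ E₁} + (M 3 ρ c).real {ω | ω \ {s(x, μ)} ∈ E₂} +
          (M 3 ρ c).real {ω | ω \ {s(x, μ)} ∈ E₃} + (M 3 ρ c).real {ω | ω \ {s(x, μ)} ∈ E₄} := by
        refine (measureReal_union_le _ _).trans (add_le_add ?_ le_rfl)
        refine (measureReal_union_le _ _).trans (add_le_add ?_ le_rfl)
        exact measureReal_union_le _ _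
    _ ≤ 1 / (1 - c) * (M 3 ρ c).real (PIV (Bs z 0)) +
          1 / (1 - c) * (16 * (M 3 ρ c).real (PIV (Bs (z + Pi.single 0 1) 1))) +
          1 / (1 - c) * (16 * (16 * (M 3 ρ c).real (PIV (Bs (z + Pi.single 1 1) 0)))) +
          1 / (1 - c) * (16 * (16 * (16 * (M 3 ρ c).real (PIV (Bs z 1))))) :=
        add_le_add (add_le_add (add_le_add h1 h2) h3) h4
    _ ≤ 4369 / (1 - c) * ((M 3 ρ c).real (PIV (Bs z 0)) + (M 3 ρ c).real (PIV (Bs (z + Pi.single 0 1) 1)) +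
          (M 3 ρ c).real (PIV (Bs (z + Pi.single 1 1) 0)) + (M 3 ρ c).real (PIV (Bs z 1))) := by
        have e4369 : (4369 : ℝ) / (1 - c) = 4369 * (1 / (1 - c)) := by ring
        rw [e4369]
        nlinarith [hP (Bs z 0), hP (Bs (z + Pi.single 0 1) 1), hP (Bs (z + Pi.single 1 1) 0), hP (Bs z 1),
          mul_nonneg hq (hP (Bs z 0)), mul_nonneg hq (hP (Bs (z + Pi.single 0 1) 1)),
          mul_nonneg hq (hP (Bs (z + Pi.single 1 1) 0)), mul_nonneg hq (hP (Bs z 1))]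


/-! ## The measure bound per non-axial edge -/

/-- **Corner transfer (B″₃), per interior edge** (registered helper of `stub_cornerLocalSlope`).
For `k = 3`, `0 < η`, `20η ≤ r`, any real `ρ`, `0 ≤ c < 1`, and a NON-AXIAL edge `edgeOf (v, d)`
whose two ends are drawn at distance `≥ r` from every side of every quad (the far members of the
Finset `Wn` of `stub_Dc_eq_sum_pivotal`), with `z = tb 3 (v, d)` the base of its cell:
`M_3(ρ,c)(edgeOf (v,d) pivotal for Aloc) ≤ 4369/(1−c) · (M(PIV_{(z,0)}) + M(PIV_{(z+e₀,1)}) + M(PIV_{(z+e₁,0)}) + M(PIV_{(z,1)}))`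
in the currency `PIV_B = {ω ∪ B ∈ Aloc ∧ ω ∖ B ∉ Aloc}` of `Drho_add_mul_Dc_ge_of_far` (one end of
the edge is an interior vertex of its cell: `real_isPivotal_edge_le_three`). -/
theorem real_isPivotal_interior_le_three : ∀ (k m : ℕ), k = 3 → ∀ (F : Fin m → Quad (Set.univ : Set ℂ)) (η r : ℝ), 0 < η → 20 * η ≤ r → ∀ (ρ c : ℝ), c ∈ Set.Ico (0 : ℝ) 1 → ∀ (v : Site 2) (d : Fin 2), ¬ ax k (v, d) → (∀ x ∈ edgeOf (v, d), ∀ (i : Fin m) (j : Fin 4), ∀ p ∈ (F i).side j, r ≤ dist ((η : ℂ) * squareLatticeEmbedding.z x) p) → (M k ρ c).real {ω | IsPivotal (Aloc m F η) (edgeOf (v, d)) ω} ≤ 4369 / (1 - c) * ((M k ρ c).real {ω | ω ∪ edgeOf '' {vd : Site 2 × Fin 2 | ax k vd ∧ tb k vd = tb k (v, d) ∧ vd.2 = 0} ∈ Aloc m F η ∧ ω \ edgeOf '' {vd : Site 2 × Fin 2 | ax k vd ∧ tb k vd = tb k (v, d) ∧ vd.2 = 0} ∉ Aloc m F η} + (M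 k ρ c).real {ω | ω ∪ edgeOf '' {vd : Site 2 × Fin 2 | ax k vd ∧ tb k vd = tb k (v, d) + Pi.single 0 1 ∧ vd.2 = 1} ∈ Aloc m F η ∧ ω \ edgeOf '' {vd : Site 2 × Fin 2 | ax k vd ∧ tb k vd = tb k (v, d) + Pi.single 0 1 ∧ vd.2 = 1} ∉ Aloc m F η} + (M k ρ c).real {ω | ω ∪ edgeOf '' {vd : Site 2 × Fin 2 | ax k vd ∧ tb k vd = tb k (v, d) + Pi.single 1 1 ∧ vd.2 = 0} ∈ Aloc m F η ∧ ω \ edgeOf '' {vd : Site 2 × Fin 2 | ax k vd ∧ tb k vd = tb k (v, d) + Pi.single 1 1 ∧ vd.2 = 0} ∉ Aloc m F η} + (M k ρ c).real {ω | ω ∪ edgeOf '' {vd : Site 2 × Fin 2 | ax k vd ∧ tb k vd = tb k (v, d) ∧ vd.2 = 1} ∈ Aloc m F η ∧ ω \ edgeOf '' {vd : Site 2 × Fin 2 | ax k vd ∧ tb k vd = tb k (v, d) ∧ vd.2 = 1} ∉ Aloc m F η}) := by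
  intro k m hk F η r hη hηr ρ c hc v d hax hfar
  obtain ⟨x, μ, hxμe, hxμ, hx, hxe⟩ := exists_interior_end_of_not_ax_three hk hax
  rw [hxμe]
  exact real_isPivotal_edge_le_three hk m F hη hηr ρ c hc (tb k (v, d)) hx hxμ (fun i j p hp => hfar x hxe i j p hp)

/-! ## At most eighteen edge labels per cell -/

/-- At most `18` labels `vd = (v, d)` have a given coarse base `tb 3 vd = z`
(`v ∈ 3z + {0,1,2}²`, `d ∈ {0,1}`): the map `vd ↦ (v₀ mod 3, v₁ mod 3, d)` is injective on them. -/
theorem card_filter_tb_eq_le_eighteen (VD : Finset (Site 2 × Fin 2)) (z : Site 2) :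
    (VD.filter (fun vd => tb 3 vd = z)).card ≤ 18 := by
  classical
  set f : Site 2 × Fin 2 → ℤ × ℤ × Fin 2 := fun vd => (vd.1 0 % 3, vd.1 1 % 3, vd.2) with hf
  have hcard : (({0, 1, 2} : Finset ℤ) ×ˢ (({0, 1, 2} : Finset ℤ) ×ˢ (Finset.univ : Finset (Fin 2)))).card = 18 := by
    rfl
  rw [← hcard]
  refine Finset.card_le_card_of_injOn f (fun vd _ => ?_) ?_
  · simp only [hf, Finset.coe_product, Finset.coe_insert, Finset.coe_singleton, Finset.coe_univ,
      Set.mem_prod, Set.mem_insert_iff, Set.mem_singleton_iff, Set.mem_univ, and_true]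
    omega
  · rintro ⟨v, d⟩ hvd ⟨v', d'⟩ hvd' h
    simp only [Finset.coe_filter, Set.mem_setOf_eq] at hvd hvd'
    simp only [hf, Prod.mk.injEq] at h
    obtain ⟨h0, h1, rfl⟩ := h
    have e0 := congrFun hvd.2 0
    have e1 := congrFun hvd.2 1
    have e0' := congrFun hvd'.2 0
    have e1' := congrFun hvd'.2 1
    simp only [tb, Nat.cast_ofNat] at e0 e1 e0' e1'
    refine Prod.ext (funext fun l => ?_) rfl
    fin_cases l
    · show v 0 = v' 0
      omega
    · show v 1 = v' 1
      omega

/-! ## The summed corner transfer -/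

/-- **Corner transfer (B″₃), summed** (registered helper of `stub_cornerLocalSlope`).  For `k = 3`,
`0 < η`, `20η ≤ r`, any real `ρ`, `0 ≤ c < 1`, a finite set `VD` of NON-AXIAL labels `vd` whose
edges `edgeOf vd` have both ends drawn `r`-far from every side of every quad, and a finite set `S'`
of coins containing, for every `vd ∈ VD` with cell `z = tb 3 vd`, the four side selectors
`(z,0,2)`, `(z+e₀,1,2)`, `(z+e₁,0,2)`, `(z,1,2)`:
`Σ_{vd ∈ VD} M_3(ρ,c)(edgeOf vd pivotal for Aloc) ≤ 314568/(1−c) · Σ_{i ∈ S'} M_3(ρ,c)(PIV_i)`,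
`PIV_i = {ω ∪ B_i ∈ Aloc ∧ ω ∖ B_i ∉ Aloc}` (per-edge bound of part 3; each selector is a side of the
cells of at most `4 · 18` labels: `314568 = 72 · 4369`). -/
theorem sum_real_isPivotal_interior_le_three : ∀ (k m : ℕ), k = 3 → ∀ (F : Fin m → Quad (Set.univ : Set ℂ)) (η r : ℝ), 0 < η → 20 * η ≤ r → ∀ (ρ c : ℝ), c ∈ Set.Ico (0 : ℝ) 1 → ∀ (VD : Finset (Site 2 × Fin 2)), (∀ vd ∈ VD, ¬ ax k vd ∧ ∀ x ∈ edgeOf vd, ∀ (i : Fin m) (j : Fin 4), ∀ p ∈ (F i).side j, r ≤ dist ((η : ℂ) * squareLatticeEmbedding.z x) p) → ∀ (S' : Finset (Site 2 × Fin 2 × Fin 3)), (∀ vd ∈ VD, (tb k vd, (0 : Fin 2), (2 : Fin 3)) ∈ S' ∧ (tb k vd + Pi.single 0 1, (1 : Fin 2), (2 : Fin 3)) ∈ S' ∧ (tb k vd + Pi.single 1 1, (0 : Fin 2), (2 : Fin 3)) ∈ S' ∧ (tb k vd, (1 : Fin 2), (2 : Fin 3)) ∈ S') → ∑ vd ∈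 VD, (M k ρ c).real {ω | IsPivotal (Aloc m F η) (edgeOf vd) ω} ≤ 314568 / (1 - c) * ∑ i ∈ S', (M k ρ c).real {ω | ω ∪ edgeOf '' {vd : Site 2 × Fin 2 | ax k vd ∧ tb k vd = i.1 ∧ vd.2 = i.2.1} ∈ Aloc m F η ∧ ω \ edgeOf '' {vd : Site 2 × Fin 2 | ax k vd ∧ tb k vd = i.1 ∧ vd.2 = i.2.1} ∉ Aloc m F η} := by
  intro k m hk F η r hη hηr ρ c hc VD hVD S' hS'
  classical
  subst hk
  set A : Set (BondConfig (Site 2)) := Aloc m F η with hA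
  set Bs : Site 2 → Fin 2 → Set (Sym2 (Site 2)) :=
    fun t d => edgeOf '' {vd : Site 2 × Fin 2 | ax 3 vd ∧ tb 3 vd = t ∧ vd.2 = d} with hBs
  set g : Site 2 × Fin 2 × Fin 3 → ℝ := fun i => (M 3 ρ c).real {ω | ω ∪ Bs i.1 i.2.1 ∈ A ∧ ω \ Bs i.1 i.2.1 ∉ A}
    with hg
  have hg0 : ∀ i, 0 ≤ g i := fun i => measureReal_nonneg
  -- the four side maps
  set σ₀ : Site 2 → Site 2 × Fin 2 × Fin 3 := fun t => (t, 0, 2) with hσ₀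
  set σ₁ : Site 2 → Site 2 × Fin 2 × Fin 3 := fun t => (t + Pi.single 0 1, 1, 2) with hσ₁
  set σ₂ : Site 2 → Site 2 × Fin 2 × Fin 3 := fun t => (t + Pi.single 1 1, 0, 2) with hσ₂
  set σ₃ : Site 2 → Site 2 × Fin 2 × Fin 3 := fun t => (t, 1, 2) with hσ₃
  -- charging one side map: multiplicity at most `18`
  have step : ∀ σ : Site 2 → Site 2 × Fin 2 × Fin 3, Function.Injective σ → (∀ vd ∈ VD, σ (tb 3 vd) ∈ S') →
      ∑ vd ∈ VD, g (σ (tb 3 vd)) ≤ 18 * ∑ i ∈ S', g i := by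
    intro σ hσ hS
    rw [← Finset.sum_fiberwise_of_maps_to (g := fun vd => tb 3 vd) (t := VD.image (tb 3))
      (fun vd hvd => Finset.mem_image_of_mem _ hvd)]
    have hfib : ∀ t ∈ VD.image (tb 3), ∑ vd ∈ VD with tb 3 vd = t, g (σ (tb 3 vd)) ≤ 18 * g (σ t) := by
      intro t _
      rw [Finset.sum_congr rfl fun vd hvd => by rw [(Finset.mem_filter.1 hvd).2], Finset.sum_const, nsmul_eq_mul]
      exact mul_le_mul_of_nonneg_right (by exact_mod_cast card_filter_tb_eq_le_eighteen VD t) (hg0 _)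
    have hsub : (VD.image (tb 3)).image σ ⊆ S' := by
      intro i hi
      obtain ⟨t, ht, rfl⟩ := Finset.mem_image.1 hi
      obtain ⟨vd, hvd, rfl⟩ := Finset.mem_image.1 ht
      exact hS vd hvd
    calc ∑ t ∈ VD.image (tb 3), ∑ vd ∈ VD with tb 3 vd = t, g (σ (tb 3 vd))
        ≤ ∑ t ∈ VD.image (tb 3), 18 * g (σ t) := Finset.sum_le_sum hfib
      _ = 18 * ∑ i ∈ (VD.image (tb 3)).image σ, g i := by
          rw [← Finset.mul_sum, Finset.sum_image fun x _ y _ h => hσ h]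
      _ ≤ 18 * ∑ i ∈ S', g i :=
          mul_le_mul_of_nonneg_left (Finset.sum_le_sum_of_subset_of_nonneg hsub fun i _ _ => hg0 i) (by norm_num)
  have hinj₀ : Function.Injective σ₀ := fun a b h => (Prod.mk.inj h).1
  have hinj₁ : Function.Injective σ₁ := fun a b h => add_right_cancel (Prod.mk.inj h).1
  have hinj₂ : Function.Injective σ₂ := fun a b h => add_right_cancel (Prod.mk.inj h).1
  have hinj₃ : Function.Injective σ₃ := fun a b h => (Prod.mk.inj h).1
  have h₀ := step σ₀ hinj₀ fun vd hvd => (hS' vd hvd).1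
  have h₁ := step σ₁ hinj₁ fun vd hvd => (hS' vd hvd).2.1
  have h₂ := step σ₂ hinj₂ fun vd hvd => (hS' vd hvd).2.2.1
  have h₃ := step σ₃ hinj₃ fun vd hvd => (hS' vd hvd).2.2.2
  -- the per-edge bound, summed
  have hc1 : 0 < 1 - c := by linarith [hc.2]
  have hq : (0 : ℝ) ≤ 4369 / (1 - c) := by positivity
  have hedge : ∀ vd ∈ VD, (M 3 ρ c).real {ω | IsPivotal A (edgeOf vd) ω} ≤
      4369 / (1 - c) * (g (σ₀ (tb 3 vd)) + g (σ₁ (tb 3 vd)) + g (σ₂ (tb 3 vd)) + g (σ₃ (tb 3 vd))) := by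
    rintro ⟨v, d⟩ hvd
    exact real_isPivotal_interior_le_three 3 m rfl F η r hη hηr ρ c hc v d (hVD _ hvd).1 (hVD _ hvd).2
  calc ∑ vd ∈ VD, (M 3 ρ c).real {ω | IsPivotal A (edgeOf vd) ω}
      ≤ ∑ vd ∈ VD, 4369 / (1 - c) * (g (σ₀ (tb 3 vd)) + g (σ₁ (tb 3 vd)) + g (σ₂ (tb 3 vd)) + g (σ₃ (tb 3 vd))) :=
        Finset.sum_le_sum hedge
    _ = 4369 / (1 - c) * (∑ vd ∈ VD, g (σ₀ (tb 3 vd)) + ∑ vd ∈ VD, g (σ₁ (tb 3 vd)) +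
          ∑ vd ∈ VD, g (σ₂ (tb 3 vd)) + ∑ vd ∈ VD, g (σ₃ (tb 3 vd))) := by
        rw [← Finset.mul_sum]
        simp only [Finset.sum_add_distrib]
    _ ≤ 4369 / (1 - c) * (18 * ∑ i ∈ S', g i + 18 * ∑ i ∈ S', g i + 18 * ∑ i ∈ S', g i + 18 * ∑ i ∈ S', g i) := by
        gcongr
    _ = 314568 / (1 - c) * ∑ i ∈ S', g i := by ring

end Summit.CriticalPhenomena.CardyFormulaZ2.Theorems.CardySelfRefinement

end
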